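import Mathlib
import Summits.MatrixMultiplication.MatrixMultiplication.Theses.NOFWindowCapacity

/-!
# `stub_seedMul` of line `integer-seed` (crux `Thesis`, stmt-MatrixMultiplication-7270) — sorry-free

Integer seeds multiply: indices `Fin (N₁N₂) ≃ Fin N₁ × Fin N₂`, legs `Fin.append (s₁ i₁) (s₂ i₂) : Fin (d₁+d₂) → ℤ`,
boxes `Fin (B₁B₂) ≃ Fin B₁ × Fin B₂` with componentwise membership.  Alien-freeness, the partition property and the entry
bound are componentwise; the spectrum of the product embeds into `A₁ × A₂` by `Fin.append`.
-/

set_option linter.unusedVariables false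
set_option linter.unusedSectionVars false

namespace Summit.MatrixMultiplication.MatrixMultiplication.Theorems.Thesis.IntegerSeed

/-! ## Definitions of line `integer-seed` (verbatim from `Lines/integer_seed.lean`) -/

def AlienFree {G : Type} [AddCommGroup G] {N : ℕ} (s t u : Fin N → G) (P Q R : Finset (Fin N × Fin N)) : Prop :=
  ∀ a ∈ P, ∀ b ∈ Q, ∀ c ∈ R, (t b.2 - s b.1) + (u c.2 - t c.1) = u a.2 - s a.1 → a.1 = b.1 ∧ b.2 = c.1 ∧ a.2 = c.2

def Partitions {N B : ℕ} (P Q R : Fin B → Finset (Fin N × Fin N)) : Prop :=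
  ∀ i j k : Fin N, ∃! r : Fin B, (i, k) ∈ P r ∧ (i, j) ∈ Q r ∧ (j, k) ∈ R r

noncomputable def spectrum {G : Type} [AddCommGroup G] [DecidableEq G] {N B : ℕ} (s t u : Fin N → G)
    (P Q R : Fin B → Finset (Fin N × Fin N)) : Finset G :=
  Finset.univ.biUnion fun r : Fin B => ((P r) ×ˢ (Q r) ×ˢ (R r)).image
    (fun abc => (t abc.2.1.2 - s abc.2.1.1) + (u abc.2.2.2 - t abc.2.2.1) - (u abc.1.2 - s abc.1.1))

def IntSeed (d N B K E : ℕ) : Prop :=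
  ∃ (s t u : Fin N → (Fin d → ℤ)) (P Q R : Fin B → Finset (Fin N × Fin N)),
    (∀ r, AlienFree s t u (P r) (Q r) (R r)) ∧ Partitions P Q R ∧
    (spectrum s t u P Q R).card ≤ K ∧
    (∀ i l, |s i l| ≤ (E : ℤ) ∧ |t i l| ≤ (E : ℤ) ∧ |u i l| ≤ (E : ℤ))

/-! ## `Fin.append` algebra -/

section Append
variable {m n : ℕ}

theorem append_add (f₁ g₁ : Fin m → ℤ) (f₂ g₂ : Fin n → ℤ) :
    Fin.append f₁ f₂ + Fin.append g₁ g₂ = Fin.append (f₁ + g₁) (f₂ + g₂) := by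
  ext l
  refine Fin.addCases (fun i => ?_) (fun i => ?_) l <;> simp [Fin.append_left, Fin.append_right]

theorem append_sub (f₁ g₁ : Fin m → ℤ) (f₂ g₂ : Fin n → ℤ) :
    Fin.append f₁ f₂ - Fin.append g₁ g₂ = Fin.append (f₁ - g₁) (f₂ - g₂) := by
  ext l
  refine Fin.addCases (fun i => ?_) (fun i => ?_) l <;> simp [Fin.append_left, Fin.append_right]

theorem append_inj {f₁ g₁ : Fin m → ℤ} {f₂ g₂ : Fin n → ℤ} (h : Fin.append f₁ f₂ = Fin.append g₁ g₂) :
    f₁ = g₁ ∧ f₂ = g₂ := by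
  constructor
  · ext i; simpa [Fin.append_left] using congrFun h (Fin.castAdd n i)
  · ext i; simpa [Fin.append_right] using congrFun h (Fin.natAdd m i)

theorem abs_append_le {f₁ : Fin m → ℤ} {f₂ : Fin n → ℤ} {E : ℤ} (h₁ : ∀ i, |f₁ i| ≤ E) (h₂ : ∀ i, |f₂ i| ≤ E) :
    ∀ l, |Fin.append f₁ f₂ l| ≤ E := fun l => by
  refine Fin.addCases (fun i => ?_) (fun i => ?_) l
  · simpa [Fin.append_left] using h₁ i
  · simpa [Fin.append_right] using h₂ i

end Append

/-! ## The stub -/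

theorem stub_seedMul :
    ∀ d₁ N₁ B₁ K₁ d₂ N₂ B₂ K₂ E : ℕ, IntSeed d₁ N₁ B₁ K₁ E → IntSeed d₂ N₂ B₂ K₂ E →
      IntSeed (d₁ + d₂) (N₁ * N₂) (B₁ * B₂) (K₁ * K₂) E := by
  classical
  intro d₁ N₁ B₁ K₁ d₂ N₂ B₂ K₂ E h₁ h₂
  obtain ⟨s₁, t₁, u₁, P₁, Q₁, R₁, hAF₁, hPart₁, hcard₁, hE₁⟩ := h₁
  obtain ⟨s₂, t₂, u₂, P₂, Q₂, R₂, hAF₂, hPart₂, hcard₂, hE₂⟩ := h₂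
  -- index and box equivalences
  let eN : Fin (N₁ * N₂) ≃ Fin N₁ × Fin N₂ := finProdFinEquiv.symm
  let eB : Fin (B₁ * B₂) ≃ Fin B₁ × Fin B₂ := finProdFinEquiv.symm
  -- product legs and boxes
  let s : Fin (N₁ * N₂) → (Fin (d₁ + d₂) → ℤ) := fun I => Fin.append (s₁ (eN I).1) (s₂ (eN I).2)
  let t : Fin (N₁ * N₂) → (Fin (d₁ + d₂) → ℤ) := fun I => Fin.append (t₁ (eN I).1) (t₂ (eN I).2)
  let u : Fin (N₁ * N₂) → (Fin (d₁ + d₂) → ℤ) := fun I => Fin.append (u₁ (eN I).1) (u₂ (eN I).2)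
  let P : Fin (B₁ * B₂) → Finset (Fin (N₁ * N₂) × Fin (N₁ * N₂)) := fun r =>
    Finset.univ.filter fun p => ((eN p.1).1, (eN p.2).1) ∈ P₁ (eB r).1 ∧ ((eN p.1).2, (eN p.2).2) ∈ P₂ (eB r).2
  let Q : Fin (B₁ * B₂) → Finset (Fin (N₁ * N₂) × Fin (N₁ * N₂)) := fun r =>
    Finset.univ.filter fun p => ((eN p.1).1, (eN p.2).1) ∈ Q₁ (eB r).1 ∧ ((eN p.1).2, (eN p.2).2) ∈ Q₂ (eB r).2
  let R : Fin (B₁ * B₂) → Finset (Fin (N₁ * N₂) × Fin (N₁ * N₂)) := fun r =>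
    Finset.univ.filter fun p => ((eN p.1).1, (eN p.2).1) ∈ R₁ (eB r).1 ∧ ((eN p.1).2, (eN p.2).2) ∈ R₂ (eB r).2
  -- the spectrum formula splits along `Fin.append`
  have hsplit : ∀ (a b c : Fin (N₁ * N₂) × Fin (N₁ * N₂)),
      (t b.2 - s b.1) + (u c.2 - t c.1) - (u a.2 - s a.1)
        = Fin.append ((t₁ (eN b.2).1 - s₁ (eN b.1).1) + (u₁ (eN c.2).1 - t₁ (eN c.1).1) - (u₁ (eN a.2).1 - s₁ (eN a.1).1))
            ((t₂ (eN b.2).2 - s₂ (eN b.1).2) + (u₂ (eN c.2).2 - t₂ (eN c.1).2) - (u₂ (eN a.2).2 - s₂ (eN a.1).2)) := by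
    intro a b c
    simp only [s, t, u, append_sub, append_add]
  refine ⟨s, t, u, P, Q, R, ?_, ?_, ?_, ?_⟩
  · -- alien-free, componentwise
    intro r a ha b hb c hc heq
    simp only [P, Q, R, Finset.mem_filter, Finset.mem_univ, true_and] at ha hb hc
    have heq0 : (t b.2 - s b.1) + (u c.2 - t c.1) - (u a.2 - s a.1) = 0 := sub_eq_zero.mpr heq
    rw [hsplit] at heq0
    have hzero : (0 : Fin (d₁ + d₂) → ℤ) = Fin.append (0 : Fin d₁ → ℤ) (0 : Fin d₂ → ℤ) := by
      ext l; refine Fin.addCases (fun i => ?_) (fun i => ?_) l <;> simp [Fin.append_left, Fin.append_right]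
    rw [hzero] at heq0
    obtain ⟨hc1, hc2⟩ := append_inj heq0
    obtain ⟨e1, e2, e3⟩ := hAF₁ _ _ ha.1 _ hb.1 _ hc.1 (sub_eq_zero.mp hc1)
    obtain ⟨f1, f2, f3⟩ := hAF₂ _ _ ha.2 _ hb.2 _ hc.2 (sub_eq_zero.mp hc2)
    simp only at e1 e2 e3 f1 f2 f3
    refine ⟨eN.injective (Prod.ext e1 f1), eN.injective (Prod.ext e2 f2), eN.injective (Prod.ext e3 f3)⟩
  · -- partition, componentwise
    intro I J K
    obtain ⟨r₁, hr₁, huniq₁⟩ := hPart₁ (eN I).1 (eN J).1 (eN K).1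
    obtain ⟨r₂, hr₂, huniq₂⟩ := hPart₂ (eN I).2 (eN J).2 (eN K).2
    refine ⟨eB.symm (r₁, r₂), ?_, ?_⟩
    · simp only [P, Q, R, Finset.mem_filter, Finset.mem_univ, true_and, Equiv.apply_symm_apply]
      exact ⟨⟨hr₁.1, hr₂.1⟩, ⟨hr₁.2.1, hr₂.2.1⟩, ⟨hr₁.2.2, hr₂.2.2⟩⟩
    · intro r' hr'
      simp only [P, Q, R, Finset.mem_filter, Finset.mem_univ, true_and] at hr'
      have h1 : (eB r').1 = r₁ := huniq₁ _ ⟨hr'.1.1, hr'.2.1.1, hr'.2.2.1⟩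
      have h2 : (eB r').2 = r₂ := huniq₂ _ ⟨hr'.1.2, hr'.2.1.2, hr'.2.2.2⟩
      have : eB r' = (r₁, r₂) := Prod.ext h1 h2
      rw [← this, Equiv.symm_apply_apply]
  · -- spectrum embeds into A₁ × A₂ by Fin.append
    have hsub : spectrum s t u P Q R ⊆
        ((spectrum s₁ t₁ u₁ P₁ Q₁ R₁) ×ˢ (spectrum s₂ t₂ u₂ P₂ Q₂ R₂)).image (fun vw => Fin.append vw.1 vw.2) := by
      intro v hv
      simp only [spectrum, Finset.mem_biUnion, Finset.mem_univ, true_and, Finset.mem_image,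
        Finset.mem_product] at hv
      obtain ⟨r, ⟨a, b, c⟩, ⟨ha, hb, hc⟩, rfl⟩ := hv
      simp only [P, Q, R, Finset.mem_filter, Finset.mem_univ, true_and] at ha hb hc
      rw [Finset.mem_image]
      refine ⟨(_, _), ?_, (hsplit a b c).symm⟩
      simp only [Finset.mem_product, spectrum, Finset.mem_biUnion, Finset.mem_univ, true_and, Finset.mem_image]
      constructor
      · exact ⟨(eB r).1, (((eN a.1).1, (eN a.2).1), ((eN b.1).1, (eN b.2).1), ((eN c.1).1, (eN c.2).1)),
          ⟨ha.1, hb.1, hc.1⟩, rfl⟩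
      · exact ⟨(eB r).2, (((eN a.1).2, (eN a.2).2), ((eN b.1).2, (eN b.2).2), ((eN c.1).2, (eN c.2).2)),
          ⟨ha.2, hb.2, hc.2⟩, rfl⟩
    calc (spectrum s t u P Q R).card
        ≤ (((spectrum s₁ t₁ u₁ P₁ Q₁ R₁) ×ˢ (spectrum s₂ t₂ u₂ P₂ Q₂ R₂)).image
            (fun vw => Fin.append vw.1 vw.2)).card := Finset.card_le_card hsub
      _ ≤ ((spectrum s₁ t₁ u₁ P₁ Q₁ R₁) ×ˢ (spectrum s₂ t₂ u₂ P₂ Q₂ R₂)).card := Finset.card_image_le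
      _ = (spectrum s₁ t₁ u₁ P₁ Q₁ R₁).card * (spectrum s₂ t₂ u₂ P₂ Q₂ R₂).card := Finset.card_product _ _
      _ ≤ K₁ * K₂ := Nat.mul_le_mul hcard₁ hcard₂
  · -- entry bound
    intro I l
    exact ⟨abs_append_le (fun i => (hE₁ _ i).1) (fun i => (hE₂ _ i).1) l,
      abs_append_le (fun i => (hE₁ _ i).2.1) (fun i => (hE₂ _ i).2.1) l,
      abs_append_le (fun i => (hE₁ _ i).2.2) (fun i => (hE₂ _ i).2.2) l⟩

end Summit.MatrixMultiplication.MatrixMultiplication.Theorems.Thesis.IntegerSeed
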